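/- Copyright: the b2b-balaban cell (near-miss cell 7), T⁴-continuum fan-out; row NE7b CRUX team (2), OWNER seat
t4-ne7b-p1 (gen 54) — INTERFACE REQUEST NE7b IR-54-1 «(α)-JOINT», item (J3b) part 1: the no-region reading WITH
LEVEL-DEPENDENT SIZES, its toy letters, and the flow rows from `BetaPertHyp` along tuned runs.  Released under the
licence of the surrounding project. -/
import Summits.QuantumFields.BalabanUV.T4Continuum.Support.HistoryRealiseCellsRunAssemblyWTVSSanityLWLEnd
import Summits.QuantumFields.BalabanUV.T4Continuum.Support.HistoryRealiseCellsRun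

/-!
# (α)-JOINT, part 3a: THE NO-REGION READING WITH LEVEL-DEPENDENT SIZES `ℛ₅`, ITS LETTERS `Φ₆`, AND THE FLOW ROWS
(2.5)∕(2.7)∕(2.9)∕`hprof`∕`hdrop`∕`2 ≤ R`∕`1 ≤ ℓ` DISCHARGED FROM `BetaPertHyp` ALONG TUNED RUNS, FOR ANY DATUM
(INTERFACE REQUEST NE7b IR-54-1 (J3b) part 1; owner lineage `t4-ne7b-p1` gen 54)

Summits-side support leaf of the T⁴-continuum cell (rung (B)+1 on a FINITE torus only; NOT infinite volume, NOT the
mass gap, NOT Clay; NOT a proof of NE7b — the cell's OWN estimate, NOT PRINTED, NOT PROVED).  [folklore]∕[decided toy]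
over leaf-05's parts 1–16 (`Isk`, `toyR`, `Φ₅`'s letters, `ℛ₄`'s display lemmas), the owner's
`HistoryRealiseCellsRun.runProfile_succ_le` ∕ `HistoryAssemblyRealiseRun.dropCtl_runProfile` and the `HistoryFlow`
suppliers `flowSide_of_betaPertHyp` ∕ `flowBinders_of_tuned` ∕ `exists_sizes`, REUSED BY NAME; two `def`s (`ℛ₅`, `Φ₆`)
and their display lemmas, one flow lemma (`flowRows_of_tuned`); nothing printed asserted, no `def … : Prop` fact, no
cite-tagged hypothesis, zero `sorry`.

WHY (owner item (α)-JOINT, journal `CLAIMS.log` l.36187; IR-54-1, `HOME/INBOX.md` l.18285).  leaf-05's toy reading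
`ℛ₄ F.L Rc` has CONSTANT sizes; (2.5) `B14.IsRj` pins `R_j` to the coupling `g_j`, so a constant size can only serve a
CONSTANT flow — and a constant flow has `βfun := 0`, where `BetaPertHyp` FAILS.  The joint witness of the TERMINAL
antecedent (part 4) runs on `jointData` (part 2), whose flow RUNS; it needs the record over a reading with sizes `R K t`
read off the flow (part 3b, `histReadDataLWL₅`), and the flow rows of that record discharged from `BetaPertHyp` along
tuned runs, for ANY datum — §4 here.

WHAT.  §1 `ℛ₅ L R` (no new region, no new field, sizes `R : ℕ → ℕ → ℕ`, exponents `runProfile L R`, memory `≡ 2`) and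
its process displays (all VACUOUS, or by `2 ≤ R K t` — exactly as `ℛ₄`'s).  §2 `Φ₆` = `Φ₅` with the renewal letter
`S_h` read at the level-dependent sizes; `factorRead_toy₆`, `histRead_toy₆`, `BA_le_of_le₆`.  §4 `two_le_of_isRj` and
**`flowRows_of_tuned (D) (hβ : BetaPertHyp D.βfun)`**: for `0 < b₀ ≤ ½`, `F.L·b₀ ≤ 1`, `1 ≤ rr`: some `γ₁ > 0` and `β′`
such that along EVERY bare sequence tuned within `]0, γ]`, `γ ≤ γ₁`, SOME size function `R` satisfies (2.5) on the
runs, `2 ≤ R`, (2.7) at `(β′, b₀, rr)`, (2.9) for `R`, `hprof`, `hdrop` at every horizon, and `1 ≤ log g_s⁻²`.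

HONEST.  Bookkeeping over OUR carriers; the reading names NO region, so every H3-side field it feeds is VACUOUS BY
DESIGN; the flow rows are discharged from the cell's UNPRINTED β-hypothesis `BetaPertHyp` (itself a binder of the
terminal theorem), not from print.  Nothing of Bałaban's is discharged; every R-class row of the wall stays; NE7b NOT
PRINTED ∕ NOT PROVED; spine 0∕9.  HONEST DEPENDENCY (cell): continuum YM on T⁴ ⇐ BetaPertH ∧ nine spine estimates (0/9
proved); BetaPertH ⇐ (D1) ∧ (D4) ∧ CAP+tail; G-an2-4 gates asym, D1 and NE2/3/4.  Unchanged here.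
-/

open Finset MeasureTheory
open Literature.MathematicalPhysics.QuantumFieldTheory.Balaban1983to89
open Literature.MathematicalPhysics.QuantumFieldTheory.Balaban1983to89.B16SProfile (DropCtl)
open T4PersistenceDictionary T4PersistentHistoryCount T4BankedInduction T4PrintedShapeBanking
open T4WeightBudget T4GlobalDenominator T4LiveClassFibration T4LiveStructureGas T4LiveGasToTerms T4RecordPriceSeam
open T4PartnerMultiplicity T4IndicatorShell T4MatchingAssembly T4MatchingClosure T4MatchingClosureSocket T4Continuum
open T4StabilitySocket T4BranchingRecordsGas T4TaggedShapeBanking T4CanonicalMenus T4RenewalChains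
open Summit.QuantumFields.BalabanUV.T4Continuum.HistoryFlow Summit.QuantumFields.BalabanUV.T4Continuum.HistoryGen
open Summit.QuantumFields.BalabanUV.T4Continuum.HistoryAdmissible
open Summit.QuantumFields.BalabanUV.T4Continuum.HistoryGenealogyExtraction
open Summit.QuantumFields.BalabanUV.T4Continuum.HistoryGenealogyRealise
open Summit.QuantumFields.BalabanUV.T4Continuum.HistoryGenealogyInstantiate
open Summit.QuantumFields.BalabanUV.T4Continuum.HistoryGenealogyPedigree
open Summit.QuantumFields.BalabanUV.T4Continuum.HistoryAssemblyPedigree Summit.QuantumFields.BalabanUV.T4Continuum.HistoryAssemblyTerms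
open Summit.QuantumFields.BalabanUV.T4Continuum.HistoryAssemblyMult Summit.QuantumFields.BalabanUV.T4Continuum.HistoryAssemblyMultKey
open Summit.QuantumFields.BalabanUV.T4Continuum.HistoryAssemblyRealiseRun Summit.QuantumFields.BalabanUV.T4Continuum.HistorySocketTH
open Summit.QuantumFields.BalabanUV.T4Continuum.HistoryRealiseDistinct
open Summit.QuantumFields.BalabanUV.T4Continuum.HistoryRealiseCellsRunApexT3bWTVS
open Summit.QuantumFields.BalabanUV.T4Continuum.B16HistoryIndexedRepr
open Summit.QuantumFields.BalabanUV.T4Continuum.B16HistoryIndexedTrunc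
open Summit.QuantumFields.BalabanUV.T4Continuum.HistoryBankingLE Summit.QuantumFields.BalabanUV.T4Continuum.HistoryBankingVolumePlug
open Summit.QuantumFields.BalabanUV.T4Continuum.HistoryConstants Summit.QuantumFields.BalabanUV.T4Continuum.HistoryBankingDiscountCharge
open Summit.QuantumFields.BalabanUV.T4Continuum.HistoryBankingCreditRead Summit.QuantumFields.BalabanUV.T4Continuum.HistoryBankingFibreRoom
open Summit.QuantumFields.BalabanUV.T4Continuum.HistoryPriceNodeSum Summit.QuantumFields.BalabanUV.T4Continuum.HistoryPriceKeys
open Summit.QuantumFields.BalabanUV.T4Continuum.HistoryRealiseCellsRunSupplyWTVS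
open Summit.QuantumFields.BalabanUV.T4Continuum.HistoryRealiseCellsRunSupplyKeysWTVS
open Summit.QuantumFields.BalabanUV.T4Continuum.HistoryRealiseCellsRunSupplyWTVSSanity
open Summit.QuantumFields.BalabanUV.T4Continuum.HistoryRealiseCellsRunSupplyKeysWTVSSanity
open Summit.QuantumFields.BalabanUV.T4Continuum.HistoryRealiseCellsRunAssemblyWTVSData
open Summit.QuantumFields.BalabanUV.T4Continuum.HistoryRealiseCellsRunAssemblyWTVS
open Summit.QuantumFields.BalabanUV.T4Continuum.HistoryRealiseCellsRunAssemblyWTVSDataL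
open Summit.QuantumFields.BalabanUV.T4Continuum.HistoryRealiseCellsRunAssemblyWTVSDataLW
open Summit.QuantumFields.BalabanUV.T4Continuum.HistoryRealiseCellsRunAssemblyWTVSDataLWL
open Summit.QuantumFields.BalabanUV.T4Continuum.HistoryRealiseCellsRunAssemblyWTVSSanity
open Summit.QuantumFields.BalabanUV.T4Continuum.HistoryRealiseCellsRun (runProfile_succ_le)
open Summit.QuantumFields.BalabanUV.T4Continuum.HistoryBankingSharpShares (ell sBsharp)
open Summit.QuantumFields.BalabanUV.T4Continuum.HistoryBankingRoundingUnrounded (sRunr ApFlat)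
open Summit.QuantumFields.BalabanUV.T4Continuum.HistoryBankingVolumeWindowLattice (uvolL uvolL_nonneg uvolL_eq_mul_uvol)

namespace Summit.QuantumFields.BalabanUV.T4Continuum.HistoryRealiseCellsRunAssemblyWTVSJointReading

noncomputable section

-- the structural `DecidableEq` instance of the concrete tag type exceeds the default synthesis size (as in the siblings)
set_option synthInstance.maxSize 1024

open B16HistoryIndexedRepr.Sanity B16HistoryIndexedRepr.SanityInput HistoryConstants.Sanity HistoryBankingCreditRead.Sanity

/-! ## §1 The no-region reading with level-dependent sizes -/

/-- **THE NO-REGION READING AT BLOCKING PARAMETER `L` WITH SIZES `R K t`**: no new region, no new field; exponents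
`s := runProfile L R` ((c1) BY CONSTRUCTION), memory `Rm ≡ 2`.  leaf-05's `ℛ₄ L Rc` is the case `R := fun _ _ => Rc`.
[folklore] -/
def ℛ₅ (L : ℕ) (R : ℕ → ℕ → ℕ) : HistReading Isk 1 where
  L := L
  s := runProfile L R
  R := R
  Rm _ _ _ := 2
  N _ _ _ _ := ∅
  cls _ _ _ _ := 0
  F _ _ _ _ := ∅

variable (L : ℕ) (R : ℕ → ℕ → ℕ)

/-- the runs read off `ℛ₅ L R` name no region, hence have no component at any level [folklore] -/
theorem comp_run_eq_empty₅ (K : ℕ) (τ : HIndex.Idx Isk) (j : ℕ) : ((ℛ₅ L R).inputOf.run K τ).histV.comp j = ∅ :=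
  ((ℛ₅ L R).inputOf.run K τ).comp_histV_eq_empty_of_N (fun _ => rfl) j

/-- nor has the real bookkeeping of the run read off a history choice [folklore] -/
theorem compM_runOf_eq_empty₅ (K : ℕ) (a : (Isk K).Adm) (ι : (Isk K).HZ × (Isk K).HL × (Isk K).HC) (j : ℕ) :
    ((ℛ₅ L R).runOf K a ι).histM.comp j = ∅ :=
  ((ℛ₅ L R).runOf K a ι).comp_histM_eq_empty_of_N (fun _ => rfl) j

/-- nothing dies [folklore] -/
theorem died_run_eq_empty₅ (K : ℕ) (τ : HIndex.Idx Isk) (j : ℕ) : ((ℛ₅ L R).inputOf.run K τ).histV.died j = ∅ :=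
  ((ℛ₅ L R).inputOf.run K τ).died_histV_eq_empty_of_N (fun _ => rfl) j

/-- no live name at any cutoff [folklore] -/
theorem liveCV_eq_empty₅ (K : ℕ) (τ : HIndex.Idx Isk) : (ℛ₅ L R).inputOf.liveCV K τ = ∅ := by
  show (((ℛ₅ L R).inputOf.run K τ).histV.comp K).image (Prod.mk K) = ∅
  rw [comp_run_eq_empty₅, Finset.image_empty]

/-- `NewOK` (vacuous) [folklore] -/
theorem newOK_run₅ (K : ℕ) (τ : HIndex.Idx Isk) : ((ℛ₅ L R).inputOf.run K τ).NewOK :=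
  ⟨fun _ _ hn => by simp [HistReading.inputOf, ℛ₅] at hn⟩

/-- `NewDisjoint` (vacuous) [folklore] -/
theorem newDisjoint_run₅ (K : ℕ) (τ : HIndex.Idx Isk) : ((ℛ₅ L R).inputOf.run K τ).NewDisjoint :=
  fun _ _ hn => by simp [HistReading.inputOf, ℛ₅] at hn

/-- `RegionsInBox` (vacuous) [folklore] -/
theorem regionsInBox_run₅ (n K : ℕ) (τ : HIndex.Idx Isk) : ((ℛ₅ L R).inputOf.run K τ).RegionsInBox n K :=
  fun _ _ _ hn => by simp [HistReading.inputOf, ℛ₅] at hn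

variable {R} in
/-- memory domination `Rm ≤ R` from `2 ≤ R K t` [folklore] -/
theorem rm_le_run₅ (hR2 : ∀ K t, 2 ≤ R K t) (K : ℕ) (τ : HIndex.Idx Isk) :
    ∀ t k, ((ℛ₅ L R).inputOf.run K τ).Rm t k ≤ ((ℛ₅ L R).inputOf.run K τ).R t := fun _ _ => hR2 _ _

variable {R} in
/-- its one-step form [folklore] -/
theorem rmS_run₅ (hR2 : ∀ K t, 2 ≤ R K t) (K : ℕ) (τ : HIndex.Idx Isk) :
    ∀ t k, ((ℛ₅ L R).inputOf.run K τ).Rm t (k + 1) ≤ ((ℛ₅ L R).inputOf.run K τ).R (t + 1) := fun _ _ => hR2 _ _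

/-- non-degenerate memory [folklore] -/
theorem rm2_run₅ (K : ℕ) (τ : HIndex.Idx Isk) : ∀ t, 2 ≤ ((ℛ₅ L R).inputOf.run K τ).Rm t 1 := fun _ => le_rfl

/-- no bad term [folklore] -/
theorem not_mem_badTerms₅ {γ : Type*} [DecidableEq γ] (cellOf : ℕ → HIndex.Idx Isk → ℕ × Lab 1 → γ) (jstar : ℕ → ℕ)
    (K : ℕ) (τ : HIndex.Idx Isk) :
    τ ∉ badTerms (memOf (ℛ₅ L R).inputOf.pedV (ℛ₅ L R).inputOf.liveCV cellOf) jstar (HIndex.termSet Isk) K := by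
  intro h
  have h' := (Finset.mem_filter.1 h).2
  unfold memOf at h'
  rw [liveCV_eq_empty₅, Finset.image_empty] at h'
  simp at h'

/-- no bad key class [folklore] -/
theorem not_mem_badGMems₅ {γ δ : Type*} [DecidableEq γ] [DecidableEq δ] (cellOf : ℕ → HIndex.Idx Isk → ℕ × Lab 1 → γ)
    (phys : ℕ → HIndex.Idx Isk → ℕ × Lab 1 → δ) (jstar : ℕ → ℕ) (K : ℕ) (k : Finset (γ × Gen PEv × δ)) :
    k ∉ badGMems (memOf (ℛ₅ L R).inputOf.pedV (ℛ₅ L R).inputOf.liveCV cellOf) jstar (HIndex.termSet Isk)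
      (kmemOf (ℛ₅ L R).inputOf.pedV (ℛ₅ L R).inputOf.liveCV cellOf phys) K := by
  intro h
  obtain ⟨τ, hτ, -⟩ := Finset.mem_image.1 h
  exact not_mem_badTerms₅ L R cellOf jstar K τ hτ

/-! ## §2 Toy letters with the renewal exponent at the level-dependent sizes -/

section Letters

variable (O : PrintedO1s) (m : ℝ) (C : T4PrintedShapeBanking.Consts) (Lr : ℝ) (p₁ : ℕ) (R : ℕ → ℕ → ℕ)
  (g : ℕ → ℕ → ℝ) (Z : ℕ → ℝ → ℝ) (Λ : ℕ → ℕ → ℝ)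

/-- **TOY FACTOR DATA AT ANY LEVEL COST `Λ`, RENEWAL LETTER AT THE SIZES `R K`**: leaf-05's `Φ₅` with `S_h` read at
`R K` instead of a constant. [folklore] -/
def Φ₆ (hΛ1 : ∀ K t, 1 ≤ Λ K t) : HistFactors Isk 1 where
  fB K j d _ := Real.exp (-sBsharp O m C (g K) j d)
  fR K h := Real.exp (-sRunr O.γ₀ O.A₁ O.M Lr O.β₀ O.d p₁ (R K) (g K) h)
  Λ := Λ
  one_le_Λ := hΛ1
  wZ _ _ _ _ := 1
  wY _ _ _ _ := 1
  wC _ _ _ _ := 1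
  BA K t := Real.log (Z K t / 6)
  BV _ _ _ _ _ _ := 0

variable (hΛ1 : ∀ K t, 1 ≤ Λ K t)

/-- the factor reading holds at the letter `S_h` read at `(ℛ₅ L R).R K = R K` — with equality [folklore] -/
theorem factorRead_toy₆ (L K : ℕ) :
    FactorRead ((Φ₆ O m C Lr p₁ R g Z Λ hΛ1).fB K) ((Φ₆ O m C Lr p₁ R g Z Λ hΛ1).fR K) (sBsharp O m C (g K))
      (sRunr O.γ₀ O.A₁ O.M Lr O.β₀ O.d p₁ ((ℛ₅ L R).R K) (g K)) :=
  factorRead_exp _ _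

/-- `HistRead` holds for `Φ₆` and the toy expansions on `ℛ₅ L R` (empty forest; envelopes attained). [folklore] -/
theorem histRead_toy₆ (L : ℕ) : HistRead (ℛ₅ L R) (Φ₆ O m C Lr p₁ R g Z Λ hΛ1) (fun K t => toyR (Z K t)) 1 0 where
  χ01 _ _ _ _ := ⟨zero_le_one, le_rfl⟩
  tz_le _ _ _ _ _ _ _ _ := le_of_eq rfl
  ty_le _ _ _ _ _ _ _ _ := le_of_eq rfl
  tc_le _ _ _ _ _ _ _ _ := le_of_eq rfl
  A'_le _ _ _ _ _ := le_rfl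
  Vs_le _ _ _ _ _ _ _ _ _ := le_rfl
  forest_le K t _ _ a ι _ := by
    show (1 : ℝ) * 1 ≤ _
    rw [Finset.prod_congr rfl fun j _ => by rw [compM_runOf_eq_empty₅ L R K a ι j, Finset.prod_empty],
      Finset.prod_const_one]
    norm_num

variable {Z} in
/-- the completed-action envelope is bounded along `|t| ≤ 1` by `log (Zi∕6)` [folklore] -/
theorem BA_le_of_le₆ {Zi : ℝ} (hpos : ∀ K t, |t| ≤ 1 → 0 < Z K t) (hle : ∀ K t, |t| ≤ 1 → Z K t ≤ Zi) (K : ℕ) {t : ℝ}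
    (ht : |t| ≤ 1) : (Φ₆ O m C Lr p₁ R g Z Λ hΛ1).BA K t ≤ Real.log (Zi / 6) :=
  Real.log_le_log (by have := hpos K t ht; positivity) (by have := hle K t ht; linarith)

end Letters

/-! ## §4 The flow rows from `BetaPertHyp` along tuned runs, for any datum -/

section Flow

variable {F : T4Family} {G : Type*} [GaugeGroup G] [MeasurableSpace G] [HaarData G]

/-- `2 ≤ R` for a size obeying (2.5) at a coupling with `2 ≤ log g⁻²` and exponent `rr ≥ 1` (`R = L^s`, `s ≥ 1`,
`L ≥ 2`). [folklore] -/
theorem two_le_of_isRj {L rr : ℕ} (hL : 2 ≤ L) (hrr : 1 ≤ rr) {g : ℝ} {Rj : ℕ} (hR : B14.IsRj L rr g Rj)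
    (h2 : 2 ≤ Real.log (g ^ 2)⁻¹) : 2 ≤ Rj := by
  obtain ⟨s, hs, hle, -⟩ := hR
  have hpow : (2 : ℝ) ≤ (Real.log (g ^ 2)⁻¹) ^ rr := by
    calc (2 : ℝ) = 2 ^ 1 := by norm_num
      _ ≤ 2 ^ rr := pow_le_pow_right₀ (by norm_num) hrr
      _ ≤ (Real.log (g ^ 2)⁻¹) ^ rr := pow_le_pow_left₀ (by norm_num) h2 rr
  have hs1 : s ≠ 0 := by
    rintro rfl
    have h1 : (Rj : ℝ) = 1 := by rw [hs]; simp
    linarith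
  rw [hs]
  calc 2 ≤ L := hL
    _ = L ^ 1 := (pow_one L).symm
    _ ≤ L ^ s := Nat.pow_le_pow_right (by omega) (Nat.one_le_iff_ne_zero.mpr hs1)

/-- **THE SEVEN FLOW ROWS OF `histReadDataLWL₅` ALONG TUNED RUNS, FROM `BetaPertHyp`** (any datum).  For `0 < b₀ ≤ ½`,
`F.L·b₀ ≤ 1`, `1 ≤ rr`: some `γ₁ > 0` and `β′` such that for every `γ ∈ ]0, γ₁]` and every bare sequence tuned within
`]0, γ]`, SOME sizes `R` obey (2.5) on the runs, are `≥ 2` everywhere, the runs obey (2.7) at `(β′, b₀, rr)` and (2.9)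
for `R`, the run profile is non-increasing with drop control at every horizon, and `1 ≤ log g_s⁻²` along the runs.
[folklore] -/
theorem flowRows_of_tuned (D : FiniteEpsData F G) (hβ : BetaPertHyp D.βfun) {b₀ : ℝ} (hb₀ : 0 < b₀)
    (hb₁ : b₀ ≤ 1 / 2) (hLb : (F.L : ℝ) * b₀ ≤ 1) {rr : ℕ} (hrr : 1 ≤ rr) :
    ∃ γ₁ : ℝ, 0 < γ₁ ∧ ∃ β' : ℝ, ∀ γ : ℝ, 0 < γ → γ ≤ γ₁ → ∀ (g : ℝ) (g₀ : ℕ → ℝ), D.Tuned γ g g₀ →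
      ∃ R : ℕ → ℕ → ℕ,
        (∀ K s, s ≤ K → B14.IsRj F.L rr ((D.C ⟨K, F.m, g₀ K⟩).flow.g s) (R K s)) ∧
        (∀ K t, 2 ≤ R K t) ∧
        (∀ K, B14.FlowIneq27 (D.C ⟨K, F.m, g₀ K⟩).flow.g β' b₀ rr K) ∧
        (∀ K, B14FlowStep.FlowIneq29 (R K) (D.C ⟨K, F.m, g₀ K⟩).flow.g F.L β' b₀ K) ∧
        (∀ K t, t < K → runProfile F.L R K (t + 1) ≤ runProfile F.L R K t) ∧
        (∀ K m, DropCtl (runProfile F.L R K) m) ∧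
        (∀ K s, s ≤ K → 1 ≤ Real.log (((D.C ⟨K, F.m, g₀ K⟩).flow.g s) ^ 2)⁻¹) := by
  obtain ⟨γ₀, b, β', hγ₀, hb, hbβ, hlo, hhi, γ₁, hγ₁, hγ₁₀, hS⟩ :=
    flowSide_of_betaPertHyp D hβ hb₀ (hb₁.trans (by norm_num)) hLb rr
  refine ⟨γ₁, hγ₁, β', fun γ hγ hγle g g₀ ht => ?_⟩
  obtain ⟨S, hγβ⟩ := hS γ hγ hγle
  have hγ' : γ ≤ γ₀ := hγle.trans hγ₁₀
  -- sizes by (2.5), frozen at the cutoff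
  obtain ⟨R₀, hR₀⟩ := exists_sizes (two_le_L F) rr fun K s => (D.C ⟨K, F.m, g₀ K⟩).flow.g s
  set R : ℕ → ℕ → ℕ := fun K t => R₀ K (min t K) with hRdef
  have hR : ∀ K s, s ≤ K → B14.IsRj F.L rr ((D.C ⟨K, F.m, g₀ K⟩).flow.g s) (R K s) := by
    intro K s hs
    show B14.IsRj F.L rr _ (R₀ K (min s K))
    rw [min_eq_left hs]
    exact hR₀ K s
  obtain ⟨h27, h29, hx1, -⟩ := flowBinders_of_tuned D hb.le hlo hhi hγ' hγβ S le_rfl le_rfl ht R hR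
  have h2 : ∀ K s, s ≤ K → 2 ≤ Real.log (((D.C ⟨K, F.m, g₀ K⟩).flow.g s) ^ 2)⁻¹ := by
    intro K s hs
    have hI := (ht K).1 s hs
    have h0 : (0 : ℝ) ≤ rr := Nat.cast_nonneg rr
    exact (show (2 : ℝ) ≤ 4 * rr + 2 by linarith).trans
      (S.h27a.trans (B14FlowStep.log_inv_sq_mono hI.1 hI.2))
  refine ⟨R, hR, fun K t => ?_, h27, h29,
    fun K => runProfile_succ_le D hb.le hlo hhi hγ' hγβ S ht R hR K,
    fun K => dropCtl_runProfile D hb.le hlo hhi hγ' hγβ S le_rfl hb₁ ht R hR K, hx1⟩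
  have hmin : min t K ≤ K := min_le_right _ _
  have := two_le_of_isRj (two_le_L F) hrr (hR K (min t K) hmin) (h2 K (min t K) hmin)
  show 2 ≤ R₀ K (min t K)
  simpa [hRdef, min_eq_left hmin] using this

end Flow

end

end Summit.QuantumFields.BalabanUV.T4Continuum.HistoryRealiseCellsRunAssemblyWTVSJointReading
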